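import Summits.QuantumFields.YangMills.Theorems.F4SubCurvatureDoorFibreDichotomyHarmonicMomentOffOrigin
import Summits.QuantumFields.YangMills.Theorems.F4SubCurvatureDoorFischerNormalForm
import Literature.Analysis.Calculus.SpherePolynomialDensity
import Mathlib
import HarnessLib

/-!
# LINE g21-B «fibre dichotomy» (⟨stmt-QuantumFields-23125⟩) — B4 helper: a function on `S³` orthogonal to all harmonic
# homogeneous polynomials of positive degree is constant (stub plan step H7)

Helper toward the registered stub B4 `stub_singleShellDichotomy` (stub plan `Lines/fibre_dichotomy_stubplans.md`, H7
`radial_of_orthogonal_harmonics`).  Let `f : ℝ⁴ → ℝ` be continuous off the origin and suppose `∫_{S³} Y · f dσ = 0` for every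
harmonic homogeneous polynomial `Y` of degree `L ≥ 1` (`σ = volume.toSphere`).  Then `f` is constant on the unit sphere.

Proof (no `L²`-completeness of spherical harmonics is used): with `m` the mean of `f` on `S³` and `f₀ = f − m`, every polynomial
`Q` satisfies `∫ Q f₀ dσ = 0` — by the Fischer normal form (tree `fischerNormalForm_spelled`) `Q = Σ_j (Σ Xᵢ²)^{e_j} H_j` equals
`Σ_j H_j` on the sphere, the harmonics `H_j` of positive degree are orthogonal to `f` by hypothesis and have mean zero
(`sphere_integral_harmonic_eq_zero`), and those of degree `0` are constants, orthogonal to `f₀` by the choice of `m`; by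
Stone–Weierstrass on the sphere (Literature `MvPoly.exists_poly_near_of_continuousOn`) `∫ f₀² dσ = 0`, whence `f₀ = 0` on `S³`
because `σ` charges open sets.

Mathlib + tree only; no `sorry`; no new definitions.  HONEST LABEL: analysis helper for a registered stub of an OPEN line; B4, B5, S1,
S2, ⟨23125⟩, ⟨23035⟩, R2d and the Yang–Mills mass gap remain OPEN; no summit is proved by a line.
-/

noncomputable section

open MeasureTheory MeasureTheory.Measure Set Function Filter Topology Metric
open scoped BigOperators

namespace Summit.QuantumFields.YangMills.Theorems.F4SubCurvatureDoorHarmonicMomentODE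

open Literature.Analysis.Calculus.MvPoly (toFun lap contDiff_toFun toFun_smul_of_isHomogeneous toFun_mul toFun_sum rho
  toFun_rho_pow_of_norm_eq_one exists_poly_near_of_continuousOn)
open Summit.QuantumFields.YangMills.Theorems.F4SubCurvatureDoorLaplaceFourierRegistered (E4)
open Summit.QuantumFields.YangMills.Theorems.F4SubCurvatureDoorFischerNormalForm (fischerNormalForm_spelled)

/-! ## Integration of continuous functions on the sphere -/

/-- A function continuous off the origin restricts to a continuous function on the unit sphere. -/
theorem continuous_sphere_restrict {f : E4 → ℝ} (hf : ContinuousOn f {0}ᶜ) :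
    Continuous fun α : sphere (0 : E4) 1 => f α :=
  hf.comp_continuous continuous_subtype_val fun α => by
    simp only [mem_compl_iff, mem_singleton_iff]
    exact ne_zero_of_mem_unit_sphere α

/-- Continuous functions on the unit sphere are integrable for the finite measure `σ`. -/
theorem integrable_sphere {h : sphere (0 : E4) 1 → ℝ} (hh : Continuous h) :
    Integrable h (volume : Measure E4).toSphere :=
  integrableOn_univ.1 (hh.continuousOn.integrableOn_compact isCompact_univ)

/-- The unit sphere `S³` has positive, finite `σ`-measure. -/
theorem sphere_measure_toReal_pos : 0 < ((volume : Measure E4).toSphere univ).toReal := by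
  have hne : (univ : Set (sphere (0 : E4) 1)).Nonempty :=
    ⟨⟨EuclideanSpace.single 0 1, by simp [PiLp.norm_single]⟩, mem_univ _⟩
  exact ENNReal.toReal_pos (isOpen_univ.measure_ne_zero (volume : Measure E4).toSphere hne) (measure_ne_top _ _)

/-- A homogeneous polynomial of degree `0` is constant as a function. -/
theorem toFun_eq_of_isHomogeneous_zero {H : MvPolynomial (Fin 4) ℝ} (hH : H.IsHomogeneous 0) (x : E4) :
    toFun H x = toFun H 0 := by
  have h := toFun_smul_of_isHomogeneous hH 0 x
  rw [zero_smul, pow_zero, one_mul] at h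
  exact h.symm

/-! ## Orthogonality to all polynomials -/

/-- **Orthogonality to harmonics of positive degree propagates to all polynomials after centring.**  If `∫ Y f dσ = 0` for every
harmonic homogeneous `Y` of degree `≥ 1`, then with `m = (∫ f dσ)/σ(S³)` every polynomial `Q` has `∫ Q · (f − m) dσ = 0`
(Fischer normal form on the sphere + mean zero of harmonics of positive degree). -/
theorem integral_poly_mul_centred_eq_zero {f : E4 → ℝ} (hf : ContinuousOn f {0}ᶜ)
    (horth : ∀ (L : ℕ) (P : MvPolynomial (Fin 4) ℝ), 1 ≤ L → P.IsHomogeneous L → lap P = 0 →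
      ∫ α, toFun P (α : E4) * f α ∂(volume : Measure E4).toSphere = 0)
    (Q : MvPolynomial (Fin 4) ℝ) :
    ∫ α, toFun Q (α : E4) * (f α - (∫ β, f β ∂(volume : Measure E4).toSphere) / ((volume : Measure E4).toSphere univ).toReal)
      ∂(volume : Measure E4).toSphere = 0 := by
  set σ := (volume : Measure E4).toSphere with hσ
  set m : ℝ := (∫ β, f β ∂σ) / (σ univ).toReal with hm
  have hfc : Continuous fun α : sphere (0 : E4) 1 => f α := continuous_sphere_restrict hf
  have hf0c : Continuous fun α : sphere (0 : E4) 1 => f α - m := hfc.sub continuous_const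
  -- Fischer normal form of `Q`
  obtain ⟨M, H, d, e, hHd, hHharm, hQ⟩ := fischerNormalForm_spelled Q
  -- on the sphere `Q = Σ_j H_j`
  have hsph : ∀ α : sphere (0 : E4) 1, toFun Q (α : E4) = ∑ j, toFun (H j) (α : E4) := by
    intro α
    rw [hQ, toFun_sum]
    refine Finset.sum_congr rfl fun j _ => ?_
    rw [toFun_mul, show (∑ i : Fin 4, MvPolynomial.X i ^ 2 : MvPolynomial (Fin 4) ℝ) = rho from rfl,
      toFun_rho_pow_of_norm_eq_one _ (norm_eq_of_mem_sphere α), one_mul]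
  -- each harmonic piece is orthogonal to `f − m`
  have hpiece : ∀ j, ∫ α, toFun (H j) (α : E4) * (f α - m) ∂σ = 0 := by
    intro j
    have hi1 : Integrable (fun α : sphere (0 : E4) 1 => toFun (H j) (α : E4) * f α) σ :=
      integrable_sphere ((continuous_toFun_sphere (H j)).mul hfc)
    have hi2 : Integrable (fun α : sphere (0 : E4) 1 => toFun (H j) (α : E4) * m) σ :=
      integrable_sphere ((continuous_toFun_sphere (H j)).mul continuous_const)
    have hsplit : ∫ α, toFun (H j) (α : E4) * (f α - m) ∂σ =
        (∫ α, toFun (H j) (α : E4) * f α ∂σ) - ∫ α, toFun (H j) (α : E4) * m ∂σ := by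
      rw [← integral_sub hi1 hi2]
      exact integral_congr_ae (ae_of_all _ fun α => by ring)
    rw [hsplit]
    rcases Nat.eq_zero_or_pos (d j) with h0 | hpos
    · -- degree `0`: `H j` is the constant `c`, and `∫ c f − ∫ c m = c (∫ f − m σ(S³)) = 0`
      have hconst : ∀ α : sphere (0 : E4) 1, toFun (H j) (α : E4) = toFun (H j) 0 := fun α =>
        toFun_eq_of_isHomogeneous_zero (h0 ▸ hHd j) _
      simp_rw [hconst]
      have hS : (σ univ).toReal ≠ 0 := sphere_measure_toReal_pos.ne'
      have hmS : (σ univ).toReal * m = ∫ β, f β ∂σ := by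
        rw [hm]
        field_simp
      rw [integral_const_mul, integral_const_mul, integral_const, smul_eq_mul, measureReal_def, hmS, sub_self]
    · -- positive degree: hypothesis + mean zero
      rw [horth (d j) (H j) hpos (hHd j) (hHharm j), integral_mul_const,
        sphere_integral_harmonic_eq_zero hpos (hHd j) (hHharm j)]
      ring
  -- sum up
  have hint : ∀ j, Integrable (fun α : sphere (0 : E4) 1 => toFun (H j) (α : E4) * (f α - m)) σ := fun j =>
    integrable_sphere ((continuous_toFun_sphere (H j)).mul hf0c)
  calc ∫ α, toFun Q (α : E4) * (f α - m) ∂σ = ∫ α, ∑ j, toFun (H j) (α : E4) * (f α - m) ∂σ := by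
        refine integral_congr_ae (ae_of_all _ fun α => ?_)
        simp only [hsph α, Finset.sum_mul]
    _ = ∑ j, ∫ α, toFun (H j) (α : E4) * (f α - m) ∂σ := integral_finsetSum _ fun j _ => hint j
    _ = 0 := Finset.sum_eq_zero fun j _ => hpiece j

/-! ## Constancy on the sphere -/

/-- **A function on `S³` orthogonal to all harmonic homogeneous polynomials of positive degree is constant** (stub plan H7): for
`f : ℝ⁴ → ℝ` continuous off the origin with `∫_{S³} Y f dσ = 0` for all harmonic homogeneous `Y` of degree `L ≥ 1`, `f` takes the same
value at any two points of the unit sphere. -/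
theorem const_on_sphere_of_orthogonal_harmonics {f : E4 → ℝ} (hf : ContinuousOn f {0}ᶜ)
    (horth : ∀ (L : ℕ) (P : MvPolynomial (Fin 4) ℝ), 1 ≤ L → P.IsHomogeneous L → lap P = 0 →
      ∫ α, toFun P (α : E4) * f α ∂(volume : Measure E4).toSphere = 0) :
    ∀ x y : E4, ‖x‖ = 1 → ‖y‖ = 1 → f x = f y := by
  set σ := (volume : Measure E4).toSphere with hσ
  set m : ℝ := (∫ β, f β ∂σ) / (σ univ).toReal with hm
  -- the centred function, continuous off the origin and on the sphere
  set f₀ : E4 → ℝ := fun x => f x - m with hf₀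
  have hf₀c : ContinuousOn f₀ {0}ᶜ := hf.sub continuousOn_const
  have hf₀s : Continuous fun α : sphere (0 : E4) 1 => f₀ α := continuous_sphere_restrict hf₀c
  have hpoly : ∀ Q : MvPolynomial (Fin 4) ℝ, ∫ α, toFun Q (α : E4) * f₀ α ∂σ = 0 := fun Q =>
    integral_poly_mul_centred_eq_zero hf horth Q
  -- `∫ f₀² dσ ≤ ε · ∫ |f₀| dσ` for every `ε > 0`, by polynomial approximation
  have hi_abs : Integrable (fun α : sphere (0 : E4) 1 => |f₀ α|) σ := integrable_sphere hf₀s.abs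
  have hi_sq : Integrable (fun α : sphere (0 : E4) 1 => f₀ α * f₀ α) σ := integrable_sphere (hf₀s.mul hf₀s)
  have hsmall : ∀ ε : ℝ, 0 < ε → ∫ α, f₀ α * f₀ α ∂σ ≤ ε * ∫ α, |f₀ α| ∂σ := by
    intro ε hε
    obtain ⟨Q, hQ⟩ := exists_poly_near_of_continuousOn hf₀c hε
    have hiQ : Integrable (fun α : sphere (0 : E4) 1 => toFun Q (α : E4) * f₀ α) σ :=
      integrable_sphere ((continuous_toFun_sphere Q).mul hf₀s)
    have hi1 : Integrable (fun α : sphere (0 : E4) 1 => (f₀ α - toFun Q (α : E4)) * f₀ α) σ :=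
      integrable_sphere ((hf₀s.sub (continuous_toFun_sphere Q)).mul hf₀s)
    have hsplit : ∫ α, f₀ α * f₀ α ∂σ = (∫ α, (f₀ α - toFun Q (α : E4)) * f₀ α ∂σ) + ∫ α, toFun Q (α : E4) * f₀ α ∂σ := by
      rw [← integral_add hi1 hiQ]
      exact integral_congr_ae (ae_of_all _ fun α => by ring)
    rw [hsplit, hpoly Q, add_zero, ← integral_const_mul]
    refine integral_mono hi1 (hi_abs.const_mul ε) fun α => ?_
    have h1 : |f₀ α - toFun Q (α : E4)| < ε := hQ α (norm_eq_of_mem_sphere α)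
    have h2 : (f₀ α - toFun Q (α : E4)) * f₀ α ≤ |f₀ α - toFun Q (α : E4)| * |f₀ α| := by
      rw [← abs_mul]; exact le_abs_self _
    exact h2.trans (mul_le_mul_of_nonneg_right h1.le (abs_nonneg _))
  -- hence `∫ f₀² dσ = 0`
  have hsq0 : ∫ α, f₀ α * f₀ α ∂σ = 0 := by
    have hnn : 0 ≤ ∫ α, f₀ α * f₀ α ∂σ := integral_nonneg fun α => mul_self_nonneg _
    have hle : ∫ α, f₀ α * f₀ α ∂σ ≤ 0 := by
      have hA : 0 ≤ ∫ α, |f₀ α| ∂σ := integral_nonneg fun α => abs_nonneg _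
      refine le_of_forall_pos_le_add fun ε hε => ?_
      have h := hsmall (ε / (1 + ∫ α, |f₀ α| ∂σ)) (by positivity)
      calc ∫ α, f₀ α * f₀ α ∂σ ≤ ε / (1 + ∫ α, |f₀ α| ∂σ) * ∫ α, |f₀ α| ∂σ := h
        _ ≤ ε := by
            rw [div_mul_eq_mul_div, div_le_iff₀ (by positivity)]
            nlinarith
        _ = 0 + ε := (zero_add ε).symm
    linarith
  -- so `f₀ = 0` on the sphere (σ charges open sets)
  have hae : (fun α : sphere (0 : E4) 1 => f₀ α * f₀ α) =ᵐ[σ] 0 :=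
    (integral_eq_zero_iff_of_nonneg (fun α => mul_self_nonneg _) hi_sq).1 hsq0
  have hzero : (fun α : sphere (0 : E4) 1 => f₀ α * f₀ α) = 0 :=
    (Continuous.ae_eq_iff_eq σ (hf₀s.mul hf₀s) continuous_const).1 hae
  have hf₀0 : ∀ α : sphere (0 : E4) 1, f₀ α = 0 := fun α => by
    have := congrFun hzero α
    simpa using this
  intro x y hx hy
  have h1 := hf₀0 ⟨x, mem_sphere_zero_iff_norm.2 hx⟩
  have h2 := hf₀0 ⟨y, mem_sphere_zero_iff_norm.2 hy⟩
  simp only [hf₀] at h1 h2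
  linarith

end Summit.QuantumFields.YangMills.Theorems.F4SubCurvatureDoorHarmonicMomentODE

end
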